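import Mathlib.Topology.Algebra.RestrictedProduct.TopologicalSpace
import Mathlib.Topology.Algebra.ContinuousMonoidHom
import Mathlib.Algebra.Group.Subgroup.Basic
import HarnessLib

/-!
# Regrouping a restricted product along a finite-to-one map of index sets

Topic `Topology/Algebra/RestrictedProduct`; namespace `Literature.Topology.Algebra.RestrictedProduct`.
For groups `G i` (`i : ι`) with subgroups `B i` and a map of index sets `f : ι → κ` with finite fibres
(`Tendsto f cofinite cofinite`), the restricted product over `ι` (Mathlib `RestrictedProduct`, cofinite filter,
with Mathlib's topology) IS the restricted product over `κ` of the finite products over the fibres: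

  `Πʳ i, [G i, B i] ≃ₜ* Πʳ k, [Π i : f⁻¹ k, G i, Π i : f⁻¹ k, B i]`     (`regroupEquiv`).

Standard (folklore); the textbook instance is the identification of the ideles of a finite extension `L/K`,
a restricted product over the places `w` of `L`, with the restricted product over the places `v` of `K` of
`Π_{w ∣ v} L_wˣ = (L ⊗_K K_v)ˣ` (e.g. Cassels–Fröhlich, *Algebraic Number Theory* (1967), Ch. II §§14–19;
Weil, *Basic Number Theory*, IV §1). Mathlib has the coordinate maps `RestrictedProduct.mapAlong`, the
universal property `RestrictedProduct.continuous_dom` / `continuous_rng_of_principal` and the structure of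
`𝓝 1`, but no regrouping isomorphism (`lean search 'regroup|fibSubgroup'` in `RestrictedProduct`: nothing).

* `Fib f k = {i // f i = k}`; `fibSubgroup B f k = Π_{i ∈ Fib f k} B i ≤ Π_{i ∈ Fib f k} G i`;
* `regroup` / `unregroup` — the two maps, mutually inverse, multiplicative, continuous (universal property on
  the principal pieces, as in Mathlib's `RestrictedProduct.mapAlong_continuous`);
* `regroupEquiv : Πʳ i, [G i, B i] ≃ₜ* Πʳ k, [Π i : Fib f k, G i, fibSubgroup B f k]`;
* `isOpen_fibSubgroup` and the `Fact` instance making the right-hand side a topological group.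

Everything is proved (Mathlib only).

## Provenance

Reproduced for the tree under the LEAN-IN-TREE rule (2026-08-18) from the pub-hodgecm formalisation cell's
standalone package file `HodgeCM/PerL34/RestrictedRegroup.lean` (DAG-node prover #09 lineage, seat pv09-g4,
gate run 26), verbatim up to the namespace (`HodgeCM.PerL34.RestrictedRegroup` ↦
`Literature.Topology.Algebra.RestrictedProduct`) and the added docstrings; there it regroups the idelic
norm-one torus `U(1)_{L/K}(𝔸_K)` over the places of `K`.
-/

set_option autoImplicit false

noncomputable section

open _root_.Topology Filter Set
open scoped RestrictedProduct

namespace Literature.Topology.Algebra.RestrictedProduct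

variable {ι κ : Type*} {G : ι → Type*} [∀ i, Group (G i)] (B : ∀ i, Subgroup (G i)) (f : ι → κ)

/-- The fibre `f⁻¹ k = {i // f i = k}` of the index map `f : ι → κ` over `k`. [folklore] -/
abbrev Fib (k : κ) : Type _ := {i : ι // f i = k}

/-- The fibre box `Π_{i ∈ f⁻¹ k} B i` as a subgroup of `Π_{i ∈ f⁻¹ k} G i`. [folklore] -/
abbrev fibSubgroup (k : κ) : Subgroup (Π i : Fib f k, G i.1) :=
  Subgroup.pi Set.univ fun i : Fib f k => B i.1

/-- Membership in the fibre box is coordinatewise membership in the `B i`. [folklore] -/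
theorem mem_fibSubgroup_iff {k : κ} (x : Π i : Fib f k, G i.1) :
    x ∈ fibSubgroup B f k ↔ ∀ i : Fib f k, x i ∈ B i.1 := by
  simp [Subgroup.mem_pi]

/-! ## The two maps -/

/-- The regrouping map `(x_i)_i ↦ ((x_i)_{i ∈ f⁻¹ k})_k` (an element of the restricted product is
eventually in the `B i`, hence its fibre tuples are eventually in the fibre boxes). [folklore] -/
def regroup (x : Πʳ i, [G i, B i]) : Πʳ k, [Π i : Fib f k, G i.1, fibSubgroup B f k] :=
  ⟨fun k i => x i.1, by
    have hfin : Set.Finite {i : ι | x i ∉ (B i : Set (G i))} := by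
      have h := x.2
      rw [eventually_cofinite] at h
      exact h
    refine (eventually_cofinite.mpr ((hfin.image f).subset ?_))
    intro k hk
    simp only [mem_setOf_eq, SetLike.mem_coe, mem_fibSubgroup_iff, not_forall] at hk
    obtain ⟨i, hi⟩ := hk
    exact ⟨i.1, hi, i.2⟩⟩

/-- Coordinates of `regroup`. [folklore] -/
@[simp] theorem regroup_apply (x : Πʳ i, [G i, B i]) (k : κ) (i : Fib f k) :
    regroup B f x k i = x i.1 := rfl

variable {f} in
/-- The inverse map `((y_{k,i})_{i ∈ f⁻¹ k})_k ↦ (y_{f i, i})_i`; the finiteness of the fibres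
(`Tendsto f cofinite cofinite`) is what makes the result eventually in the `B i`. [folklore] -/
def unregroup (hf : Tendsto f cofinite cofinite) (y : Πʳ k, [Π i : Fib f k, G i.1, fibSubgroup B f k]) :
    Πʳ i, [G i, B i] :=
  ⟨fun i => y (f i) ⟨i, rfl⟩, by
    have hy : ∀ᶠ k in cofinite, y k ∈ (fibSubgroup B f k : Set (Π i : Fib f k, G i.1)) := y.2
    filter_upwards [hf.eventually hy] with i hi
    rw [SetLike.mem_coe, mem_fibSubgroup_iff] at hi
    exact hi ⟨i, rfl⟩⟩

/-- Coordinates of `unregroup`. [folklore] -/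
@[simp] theorem unregroup_apply (hf : Tendsto f cofinite cofinite)
    (y : Πʳ k, [Π i : Fib f k, G i.1, fibSubgroup B f k]) (i : ι) :
    unregroup B hf y i = y (f i) ⟨i, rfl⟩ := rfl

/-- `unregroup ∘ regroup = id`. [folklore] -/
theorem unregroup_regroup (hf : Tendsto f cofinite cofinite) (x : Πʳ i, [G i, B i]) :
    unregroup B hf (regroup B f x) = x := by
  ext i; rfl

/-- `regroup ∘ unregroup = id`. [folklore] -/
theorem regroup_unregroup (hf : Tendsto f cofinite cofinite)
    (y : Πʳ k, [Π i : Fib f k, G i.1, fibSubgroup B f k]) : regroup B f (unregroup B hf y) = y := by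
  ext k i
  obtain ⟨i, rfl⟩ := i
  rfl

/-- `regroup` is multiplicative. [folklore] -/
theorem regroup_mul (x x' : Πʳ i, [G i, B i]) :
    regroup B f (x * x') = regroup B f x * regroup B f x' := by
  ext k; rfl

/-! ## Continuity -/

section topology

variable [∀ i, TopologicalSpace (G i)]

/-- `regroup` is continuous: by the universal property of the restricted-product topology
(Mathlib `RestrictedProduct.continuous_dom`) it suffices to check the principal pieces `Πʳ i, [G i, B i]_[𝓟 S]`,
`S` cofinite, which land continuously in the principal piece over `(f '' Sᶜ)ᶜ`. [folklore] -/
theorem continuous_regroup : Continuous (regroup B f) := by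
  rw [RestrictedProduct.continuous_dom]
  intro S hS
  have hSc : Sᶜ.Finite := by
    have : S ∈ (cofinite : Filter ι) := le_principal_iff.mp hS
    exact this
  -- the piece over `S` lands in the piece over `T := (f '' Sᶜ)ᶜ`
  set T : Set κ := (f '' Sᶜ)ᶜ with hTdef
  have hT : (cofinite : Filter κ) ≤ 𝓟 T := by
    rw [le_principal_iff, hTdef]
    exact (hSc.image f).compl_mem_cofinite
  let g : Πʳ i, [G i, B i]_[𝓟 S] → Πʳ k, [Π i : Fib f k, G i.1, fibSubgroup B f k]_[𝓟 T] :=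
    fun x => ⟨fun k i => x i.1, by
      have hx : ∀ i ∈ S, x i ∈ (B i : Set (G i)) := by
        have h := (x.2 : ∀ᶠ i in 𝓟 S, x i ∈ (B i : Set (G i)))
        rwa [eventually_principal] at h
      rw [eventually_principal]
      intro k hk
      rw [SetLike.mem_coe, mem_fibSubgroup_iff]
      intro i
      by_contra hni
      apply hk
      exact ⟨i.1, fun hiS => hni (hx i.1 hiS), i.2⟩⟩
  have hg : Continuous g := by
    rw [RestrictedProduct.continuous_rng_of_principal]
    exact continuous_pi fun k => continuous_pi fun i =>
      (continuous_apply i.1).comp RestrictedProduct.continuous_coe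
  have hfac : regroup B f ∘ RestrictedProduct.inclusion _ _ hS =
      RestrictedProduct.inclusion _ _ hT ∘ g := by
    funext x
    rfl
  rw [hfac]
  exact (RestrictedProduct.continuous_inclusion hT).comp hg

/-- `unregroup` is continuous (same argument, the piece over `T` lands in the piece over `f ⁻¹' T`). [folklore] -/
theorem continuous_unregroup (hf : Tendsto f cofinite cofinite) : Continuous (unregroup B hf) := by
  rw [RestrictedProduct.continuous_dom]
  intro T hT
  -- the piece over `T` lands in the piece over `S := f ⁻¹' T`
  have hS : (cofinite : Filter ι) ≤ 𝓟 (f ⁻¹' T) :=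
    le_principal_iff.mpr (hf (le_principal_iff.mp hT))
  let g : Πʳ k, [Π i : Fib f k, G i.1, fibSubgroup B f k]_[𝓟 T] → Πʳ i, [G i, B i]_[𝓟 (f ⁻¹' T)] :=
    fun y => ⟨fun i => y (f i) ⟨i, rfl⟩, by
      have hy : ∀ k ∈ T, y k ∈ (fibSubgroup B f k : Set (Π i : Fib f k, G i.1)) := by
        have h := (y.2 : ∀ᶠ k in 𝓟 T, y k ∈ (fibSubgroup B f k : Set (Π i : Fib f k, G i.1)))
        rwa [eventually_principal] at h
      rw [eventually_principal]
      intro i hi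
      have h := hy (f i) hi
      rw [SetLike.mem_coe, mem_fibSubgroup_iff] at h
      exact h ⟨i, rfl⟩⟩
  have hg : Continuous g := by
    rw [RestrictedProduct.continuous_rng_of_principal]
    exact continuous_pi fun i =>
      (continuous_apply (⟨i, rfl⟩ : Fib f (f i))).comp
        ((continuous_apply (f i)).comp RestrictedProduct.continuous_coe)
  have hfac : unregroup B hf ∘ RestrictedProduct.inclusion _ _ hT =
      RestrictedProduct.inclusion _ _ hS ∘ g := by
    funext y
    rfl
  rw [hfac]
  exact (RestrictedProduct.continuous_inclusion hS).comp hg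

variable {f} in
/-- **Regrouping a restricted product along a finite-to-one map of index sets**: for groups `G i` with
subgroups `B i` and `f : ι → κ` with finite fibres,
`Πʳ i, [G i, B i] ≃ₜ* Πʳ k, [Π i : f⁻¹ k, G i, Π i : f⁻¹ k, B i]` as topological groups (e.g. the ideles of `L`
over the places of `L`, regrouped over the places of a subfield `K` along `w ↦ w|_K`). [folklore] -/
def regroupEquiv (hf : Tendsto f cofinite cofinite) :
    (Πʳ i, [G i, B i]) ≃ₜ* Πʳ k, [Π i : Fib f k, G i.1, fibSubgroup B f k] where
  toFun := regroup B f
  invFun := unregroup B hf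
  left_inv := unregroup_regroup B f hf
  right_inv := regroup_unregroup B f hf
  map_mul' := regroup_mul B f
  continuous_toFun := continuous_regroup B f
  continuous_invFun := continuous_unregroup B f hf

/-- Coordinates of `regroupEquiv`. [folklore] -/
@[simp] theorem regroupEquiv_apply (hf : Tendsto f cofinite cofinite) (x : Πʳ i, [G i, B i]) (k : κ)
    (i : Fib f k) : regroupEquiv B hf x k i = x i.1 := rfl

/-- Coordinates of `regroupEquiv.symm`. [folklore] -/
@[simp] theorem regroupEquiv_symm_apply (hf : Tendsto f cofinite cofinite)
    (y : Πʳ k, [Π i : Fib f k, G i.1, fibSubgroup B f k]) (i : ι) :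
    (regroupEquiv B hf).symm y i = y (f i) ⟨i, rfl⟩ := rfl

/-- The fibres of `f` are finite when `Tendsto f cofinite cofinite`. [folklore] -/
theorem finite_fib (hf : Tendsto f cofinite cofinite) (k : κ) : Finite (Fib f k) := by
  have h : f ⁻¹' ({k}ᶜ) ∈ (cofinite : Filter ι) := hf (finite_singleton k).compl_mem_cofinite
  have h' : (f ⁻¹' {k}).Finite := by
    rw [mem_cofinite, preimage_compl, compl_compl] at h
    exact h
  exact (h'.coe_toFinset ▸ h'.toFinset.finite_toSet).to_subtype

/-- The fibre boxes `Π_{i ∈ f⁻¹ k} B i` are open when the `B i` are open and the fibres finite. [folklore] -/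
theorem isOpen_fibSubgroup (hBo : ∀ i, IsOpen (B i : Set (G i))) (hf : Tendsto f cofinite cofinite)
    (k : κ) : IsOpen (fibSubgroup B f k : Set (Π i : Fib f k, G i.1)) := by
  haveI := finite_fib f hf k
  have h : (fibSubgroup B f k : Set (Π i : Fib f k, G i.1)) =
      Set.pi Set.univ fun i : Fib f k => (B i.1 : Set (G i.1)) := by
    ext x
    simp [mem_fibSubgroup_iff]
  rw [h]
  exact isOpen_set_pi finite_univ fun i _ => hBo i.1

/-- The `Fact` instance making `Πʳ k, [Π i : Fib f k, G i, fibSubgroup B f k]` a topological group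
(Mathlib `RestrictedProduct.isTopologicalGroup`), from the corresponding `Fact`s on `B` and `f`; it is keyed by
the `Fact (Tendsto f cofinite cofinite)` argument, so it fires only where that `Fact` is provided. [folklore] -/
instance fact_isOpen_fibSubgroup [hBo : Fact (∀ i, IsOpen (B i : Set (G i)))]
    [hf : Fact (Tendsto f cofinite cofinite)] :
    Fact (∀ k, IsOpen (fibSubgroup B f k : Set (Π i : Fib f k, G i.1))) :=
  ⟨isOpen_fibSubgroup B f hBo.out hf.out⟩

example [∀ i, IsTopologicalGroup (G i)] [Fact (∀ i, IsOpen (B i : Set (G i)))]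
    [Fact (Tendsto f cofinite cofinite)] :
    IsTopologicalGroup (Πʳ k, [Π i : Fib f k, G i.1, fibSubgroup B f k]) := inferInstance

end topology

end Literature.Topology.Algebra.RestrictedProduct

end
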